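import Literature.AlgebraicGeometry.Resolution.HasseSchmidtChartOrder
import Literature.AlgebraicGeometry.Resolution.DerivativeIdealSheaf
import Literature.AlgebraicGeometry.Motives.SmoothSpread
import Mathlib.RingTheory.RingHom.StandardSmooth
import Mathlib.RingTheory.RingHom.Etale
import Mathlib.AlgebraicGeometry.AffineScheme
import HarnessLib

/-!
# Chart-uniform order equations on a scheme smooth over a perfect field

Topic: `Literature/AlgebraicGeometry/Resolution`. Scheme-level form of `HasseSchmidtChartOrder.lean`: let `K` be a
PERFECT field, `f : Z → Spec K` SMOOTH and `ξ ∈ Z` any point. Then there are an affine open `V ∋ ξ`, an integer `d` and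
ONE ring homomorphism `T : Γ(Z,V) → Γ(Z,V)⟦t_1,…,t_d⟧` with `constantCoeff ∘ T = id` fixing `K` (a Hasse–Schmidt
homomorphism of the chart; its components `D^{[β]} = hsComponent T β`, `β ∈ ℕ^d`, are `K`-linear differential operators
of `Γ(Z,V)` of order `≤ |β|`) such that for EVERY CLOSED point `η ∈ V`, every section `h ∈ Γ(Z,V)` and every `N`:

  `h_η ∈ 𝔪_η^N ⟺ (D^{[β]} h)_η ∈ 𝔪_η` for all `β` with `|β| < N`

(`exists_affineOpen_hasseSchmidt_orderEquations`): the closed points of `V` where `ord_η h ≥ N` are exactly the closed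
points of the zero set of the finitely many sections `D^{[β]} h`, `|β| < N`, and «`ord_η h = N`» is, inside that closed
set, the non-vanishing of some `D^{[β]} h` with `|β| = N` (`…_exactOrder`). Proof: a standard-smooth affine chart at `ξ`
(`Motives.exists_appLE_isStandardSmoothOfRelativeDimension_of_mem_smoothLocus`) is étale over `K[X_1,…,X_d]` (Mathlib
`RingHom.IsStandardSmoothOfRelativeDimension.exists_etale_mvPolynomial`); take the Hasse–Schmidt homomorphism of
`HasseSchmidtChartOrder.exists_hasseSchmidt_orderEquations` on `Γ(Z,V)`; a closed `η ∈ V` is a maximal ideal of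
`Γ(Z,V)` (`IsAffineOpen.primeIdealOf_isMaximal_of_isClosed`) with `𝒪_{Z,η}` its localisation
(`IsAffineOpen.isLocalization_stalk`), so the ring-level order equations apply.

Bearing (nothing of it asserted): this is the «chart-uniform Hasse–Taylor, order part» asked for by the campaign
`res-hironaka` (GAP-LEDGER R20, lead route README §2 (i)/(iii): along a chart the loci `ord_η g ≥ q` / `= q` at closed
points must be cut out by the SAME regular functions). Sources: [EGAIV4] §16.8, Thm. 16.11.2, §17.6;
[VillamayorU2008ReesDiff] §4.1, Remark 4.3; [Matsumura1987] §27.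
-/

noncomputable section

namespace Literature.AlgebraicGeometry.Resolution

open Finsupp IsLocalRing MvPowerSeries CategoryTheory TopologicalSpace _root_.AlgebraicGeometry

universe u

variable {K : Type u} [Field K] {Z : Scheme.{u}} (f : Z ⟶ Spec (.of K))

/-- **Chart-uniform order equations on a smooth scheme over a perfect field.** For `f : Z → Spec K` smooth, `K`
perfect, and any `ξ ∈ Z`: an affine open `V ∋ ξ`, `d ∈ ℕ` and a Hasse–Schmidt homomorphism
`T : Γ(Z,V) → Γ(Z,V)⟦t_{Fin d}⟧` (`constantCoeff ∘ T = id`, fixing `K` for the `K`-structure `K → Γ(Z,𝒪_Z) → Γ(Z,V)`,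
`sectionsHom`) whose components `hsComponent T β` are `K`-linear differential operators of order `≤ |β|`
(`sectionsAlgebra`), such that at EVERY CLOSED `η ∈ V`, for all `h ∈ Γ(Z,V)` and `N`:
`germ_η h ∈ 𝔪_η^N ⟺ ∀ |β| < N, germ_η (hsComponent T β h) ∈ 𝔪_η`. [cite: EGAIV4, Thm. 16.11.2 and §17.6]
[cite: VillamayorU2008ReesDiff, §4.1 and Remark 4.3] [cite: Matsumura1987, §27 (higher derivations)] -/
theorem exists_affineOpen_hasseSchmidt_orderEquations [PerfectField K] [Smooth f] (ξ : Z) :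
    ∃ (V : Z.Opens) (_ : IsAffineOpen V) (_ : ξ ∈ V) (d : ℕ)
      (T : Γ(Z, V) →+* MvPowerSeries (Fin d) Γ(Z, V)),
      (∀ a, constantCoeff (T a) = a) ∧
      (∀ c : K, T (sectionsHom (f.appTop.hom.comp (Scheme.ΓSpecIso (.of K)).inv.hom) V c) =
        MvPowerSeries.C (sectionsHom (f.appTop.hom.comp (Scheme.ΓSpecIso (.of K)).inv.hom) V c)) ∧
      (letI := sectionsAlgebra (f.appTop.hom.comp (Scheme.ΓSpecIso (.of K)).inv.hom) V
       ∀ β : Fin d →₀ ℕ, ∃ D : Γ(Z, V) →ₗ[K] Γ(Z, V), IsDiffOpLE K (degree β) D ∧ ∀ a, D a = hsComponent T β a) ∧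
      ∀ (η : Z) (hη : η ∈ V), IsClosed ({η} : Set Z) → ∀ (N : ℕ) (h : Γ(Z, V)),
        ((Z.presheaf.germ V η hη).hom h ∈ maximalIdeal (Z.presheaf.stalk η) ^ N ↔
          ∀ β : Fin d →₀ ℕ, degree β < N →
            (Z.presheaf.germ V η hη).hom (hsComponent T β h) ∈ maximalIdeal (Z.presheaf.stalk η)) := by
  set φ₀ : K →+* Γ(Z, ⊤) := f.appTop.hom.comp (Scheme.ΓSpecIso (.of K)).inv.hom with hφ₀
  -- a standard smooth affine chart at `ξ`
  have hx : ξ ∈ f.smoothLocus := by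
    rw [Scheme.Hom.smoothLocus_eq_top]
    trivial
  obtain ⟨d, ⟨U, hU⟩, ⟨V, hV⟩, hξV, e', hstd⟩ :=
    Literature.AlgebraicGeometry.Motives.exists_appLE_isStandardSmoothOfRelativeDimension_of_mem_smoothLocus f hx
  have hUtop : U = ⊤ := by
    ext y
    simp only [Opens.coe_top, Set.mem_univ, iff_true]
    have : f ξ ∈ U := e' hξV
    rwa [Subsingleton.elim y (f ξ)]
  subst hUtop
  -- its `K`-structure is the sections `K`-structure `K → Γ(Z, 𝒪_Z) → Γ(Z, V)`
  have hφ : sectionsHom φ₀ V =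
      (f.appLE ⊤ V e').hom.comp (Scheme.ΓSpecIso (.of K)).commRingCatIsoToRingEquiv.symm.toRingHom := rfl
  have hφstd : (sectionsHom φ₀ V).IsStandardSmoothOfRelativeDimension d := by
    rw [hφ]
    exact RingHom.isStandardSmoothOfRelativeDimension_respectsIso.2 _ _ hstd
  obtain ⟨g, hgC, hgEt⟩ := RingHom.IsStandardSmoothOfRelativeDimension.exists_etale_mvPolynomial hφstd
  -- algebra structures `K → K[X] → Γ(Z, V)`
  letI : Algebra K Γ(Z, V) := sectionsAlgebra φ₀ V
  letI : Algebra (MvPolynomial (Fin d) K) Γ(Z, V) := g.toAlgebra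
  haveI : IsScalarTower K (MvPolynomial (Fin d) K) Γ(Z, V) :=
    IsScalarTower.of_algebraMap_eq (R := K) (S := MvPolynomial (Fin d) K) (A := Γ(Z, V)) fun c => by
      show sectionsHom φ₀ V c = g (algebraMap K (MvPolynomial (Fin d) K) c)
      rw [MvPolynomial.algebraMap_eq, ← hgC]
      rfl
  haveI : Algebra.Etale (MvPolynomial (Fin d) K) Γ(Z, V) := hgEt
  haveI : Algebra.FormallyEtale (MvPolynomial (Fin d) K) Γ(Z, V) := Algebra.Etale.formallyEtale
  haveI : Algebra.FinitePresentation (MvPolynomial (Fin d) K) Γ(Z, V) := Algebra.Etale.finitePresentation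
  haveI : Algebra.FiniteType K Γ(Z, V) :=
    Algebra.FiniteType.trans (S := MvPolynomial (Fin d) K) inferInstance inferInstance
  -- ONE Hasse–Schmidt homomorphism on the chart with the ring-level order equations at every maximal ideal
  obtain ⟨T, hT0, hTK, hTx, hD, hord⟩ :=
    exists_hasseSchmidt_orderEquations K (σ := Fin d) (A := Γ(Z, V))
  refine ⟨V, hV, hξV, d, T, hT0, fun c => hTK c, hD, fun η hη hηc N h => ?_⟩
  -- a closed point `η ∈ V` is a maximal ideal of `Γ(Z, V)` and `𝒪_{Z,η}` is the localisation there
  letI : Algebra Γ(Z, V) (Z.presheaf.stalk η) := TopCat.Presheaf.algebra_section_stalk Z.presheaf ⟨η, hη⟩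
  haveI : IsLocalization.AtPrime (Z.presheaf.stalk η) (hV.primeIdealOf ⟨η, hη⟩).asIdeal :=
    hV.isLocalization_stalk ⟨η, hη⟩
  haveI : (hV.primeIdealOf ⟨η, hη⟩).asIdeal.IsMaximal := hV.primeIdealOf_isMaximal_of_isClosed ⟨η, hη⟩ hηc
  have key := algebraMap_mem_maximalIdeal_pow_iff_of_hasseSchmidt K (σ := Fin d) T hT0 hTK hTx
    (hV.primeIdealOf ⟨η, hη⟩).asIdeal (Z.presheaf.stalk η) N h
  have hgerm : ∀ s : Γ(Z, V), algebraMap Γ(Z, V) (Z.presheaf.stalk η) s = (Z.presheaf.germ V η hη).hom s :=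
    fun _ => rfl
  rw [hgerm] at key
  rw [key]
  refine forall_congr' fun β => forall_congr' fun _ => ?_
  rw [← hgerm, IsLocalization.AtPrime.to_map_mem_maximal_iff (Z.presheaf.stalk η) (hV.primeIdealOf ⟨η, hη⟩).asIdeal]

/-- **Exact order along a chart.** In the setting of `exists_affineOpen_hasseSchmidt_orderEquations` (same `V`, `d`,
`T`): at every closed `η ∈ V`, `germ_η h ∈ 𝔪_η^N ∖ 𝔪_η^{N+1}` iff all `germ_η (D^{[β]} h)`, `|β| < N`, lie in `𝔪_η` and
some `germ_η (D^{[β]} h)` with `|β| = N` does not — «`ord_η h = N`» is OPEN inside the closed stratum «`ord_η h ≥ N`»,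
both being read off the SAME global sections `D^{[β]} h`. [cite: EGAIV4, Thm. 16.11.2 and §17.6]
[cite: VillamayorU2008ReesDiff, §4.1 and Remark 4.3] -/
theorem exists_affineOpen_hasseSchmidt_exactOrder [PerfectField K] [Smooth f] (ξ : Z) :
    ∃ (V : Z.Opens) (_ : IsAffineOpen V) (_ : ξ ∈ V) (d : ℕ)
      (T : Γ(Z, V) →+* MvPowerSeries (Fin d) Γ(Z, V)),
      (∀ a, constantCoeff (T a) = a) ∧
      (∀ c : K, T (sectionsHom (f.appTop.hom.comp (Scheme.ΓSpecIso (.of K)).inv.hom) V c) =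
        MvPowerSeries.C (sectionsHom (f.appTop.hom.comp (Scheme.ΓSpecIso (.of K)).inv.hom) V c)) ∧
      ∀ (η : Z) (hη : η ∈ V), IsClosed ({η} : Set Z) → ∀ (N : ℕ) (h : Γ(Z, V)),
        ((Z.presheaf.germ V η hη).hom h ∈ maximalIdeal (Z.presheaf.stalk η) ^ N ∧
            (Z.presheaf.germ V η hη).hom h ∉ maximalIdeal (Z.presheaf.stalk η) ^ (N + 1)) ↔
          (∀ β : Fin d →₀ ℕ, degree β < N →
              (Z.presheaf.germ V η hη).hom (hsComponent T β h) ∈ maximalIdeal (Z.presheaf.stalk η)) ∧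
            ∃ β : Fin d →₀ ℕ, degree β = N ∧
              (Z.presheaf.germ V η hη).hom (hsComponent T β h) ∉ maximalIdeal (Z.presheaf.stalk η) := by
  obtain ⟨V, hV, hξV, d, T, hT0, hTK, -, hord⟩ := exists_affineOpen_hasseSchmidt_orderEquations f ξ
  refine ⟨V, hV, hξV, d, T, hT0, hTK, fun η hη hηc N h => ?_⟩
  rw [hord η hη hηc N h, hord η hη hηc (N + 1) h]
  constructor
  · rintro ⟨hlt, hnot⟩
    refine ⟨hlt, ?_⟩
    by_contra hne
    push Not at hne
    exact hnot fun β hβ => (Nat.lt_succ_iff_lt_or_eq.mp hβ).elim (hlt β) (hne β)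
  · rintro ⟨hlt, β, hβN, hβ⟩
    exact ⟨hlt, fun hall => hβ (hall β (by omega))⟩

end Literature.AlgebraicGeometry.Resolution

end
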